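import Literature.MathematicalPhysics.QuantumLattice.HeisenbergOrderNeelWindowDictionary
import Summits.HubbardSuperconductivity.HubbardSuperconductivity.Theorems.MesoscopicPairOrder.Negative.StonerOcticBand
import HarnessLib

/-!
# Window-dictionary kernels: the generic majorant principle (HubbardLadder R2, H₀ line; device D39)

HONEST FRAMING: ladder R1–R4 with certified numbers; no claim on H/H₀.

For a window table `w` on `S ⊂ ℕ × ℕ` and reals `b, t`, the Kennedy–Lieb–Shastry dictionary kernel of the
window dictionary `windowDict L S w` is the cosine polynomial
`K(q) = Σ_{(a,b)∈S} w(a,b) cos(a q₀) cos(b q₁) + b (cos q₀ + cos q₁)/2 + t` (tree: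
`klsKernel_windowDict`), i.e. a function `windowKernelFun S w b t q₀ q₁` of the two angles alone.  The
only kernel-specific input of the LP-ready cuts `kls_heis_windowDict_cut(_spinHalf)` is an `L`-UNIFORM
bound `𝓦_K(L) ≤ W̄` on the punctured Riemann sum
`𝓦_K(L) = L⁻² Σ_{q ≠ Q} {-K(q)}₊ (E_q/E_{q-Q})^{1/2}` (`klsKernelRiemannSum`).  This file isolates the two
generic steps of every such bound:

* `klsKernelRiemannSum_windowDict_le_of_majorant` — if a function `M(q₀,q₁) ≥ 0` of the angles dominates
  `{-K}₊ ((2-(cos q₀+cos q₁))/(2+(cos q₀+cos q₁)))^{1/2}` whenever `cos q₀ + cos q₁ > -2`, and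
  `Σ_q M ≤ L² W̄` on the torus of side `L = 2k`, then `𝓦_K(2k) ≤ W̄`;
* `sum_cosTable` — the lattice sum of a finite cosine table `Σ_{(m,m')∈T} ν(m,m') cos(m q₀) cos(m' q₁)`
  with all frequencies `< L` and `(0,0) ∉ T` vanishes (character orthogonality), so a majorant that is a
  cosine polynomial of degree `< L` has lattice average equal to its constant term — uniformly in `L`.

The per-kernel files then only supply `M`, its one-variable certificates and its cosine expansion.
-/

open Finset Literature.MathematicalPhysics.QuantumLattice Literature.Probability.LatticeModels

namespace Summit.HubbardSuperconductivity.HubbardLadder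

/-! ### The window kernel as a function of the two angles -/

/-- `K(q₀,q₁) = Σ_{(a,b)∈S} w(a,b) cos(a q₀) cos(b q₁) + b (cos q₀ + cos q₁)/2 + t`.
HONEST FRAMING: ladder R1–R4 with certified numbers; no claim on H/H₀. -/
noncomputable def windowKernelFun (S : Finset (ℕ × ℕ)) (w : ℕ × ℕ → ℝ) (b t q₀ q₁ : ℝ) : ℝ :=
  ∑ p ∈ S, w p * (Real.cos ((p.1 : ℝ) * q₀) * Real.cos ((p.2 : ℝ) * q₁)) +
    b * ((Real.cos q₀ + Real.cos q₁) / 2) + t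

/-- `cos(m q₀) cos(m' q₁)` as a function of the angles. HONEST FRAMING: ladder R1–R4 with certified
numbers; no claim on H/H₀. -/
noncomputable def cosTableFun (m m' : ℕ) (q₀ q₁ : ℝ) : ℝ :=
  Real.cos ((m : ℝ) * q₀) * Real.cos ((m' : ℝ) * q₁)

/-- Auxiliary lemma `torusCosSum_two` (support step for the results of this file; see the module docstring). -/
theorem torusCosSum_two (L : ℕ) (q : TorusSite 2 L) :
    torusCosSum L q = Real.cos (latticeMomentum L q 0) + Real.cos (latticeMomentum L q 1) := by
  simp [torusCosSum, Fin.sum_univ_two]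

/-- The tree's window kernel is `windowKernelFun` at the lattice angles.
HONEST FRAMING: ladder R1–R4 with certified numbers; no claim on H/H₀. -/
theorem klsKernel_windowDict_eq_fun (L : ℕ) [NeZero L] (S : Finset (ℕ × ℕ)) (w : ℕ × ℕ → ℝ)
    (b t : ℝ) (q : TorusSite 2 L) :
    klsKernel L (windowDict L S w) b t q =
      windowKernelFun S w b t (latticeMomentum L q 0) (latticeMomentum L q 1) := by
  rw [klsKernel_windowDict, torusCosSum_two, windowKernelFun]

/-! ### The generic majorant principle -/

/-- **Majorant principle.** If `M ≥ 0` dominates `{-K}₊ ((2-s)/(2+s))^{1/2}` (`s = cos q₀ + cos q₁ > -2`)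
and `Σ_q M(q) ≤ (2k)² W̄` on the torus of side `2k ≥ 2`, then `𝓦_K(2k) ≤ W̄`.
HONEST FRAMING: ladder R1–R4 with certified numbers; no claim on H/H₀.
[cite: KLS1988JSP, eqs. (4), (6)-(9)] -/
theorem klsKernelRiemannSum_windowDict_le_of_majorant (k : ℕ) (hk : 1 ≤ k) (S : Finset (ℕ × ℕ))
    (w : ℕ × ℕ → ℝ) (b t Wbar : ℝ) (M : ℝ → ℝ → ℝ)
    (hdom : ∀ q₀ q₁ : ℝ, -2 < Real.cos q₀ + Real.cos q₁ →
      max (-windowKernelFun S w b t q₀ q₁) 0 *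
          Real.sqrt ((2 - (Real.cos q₀ + Real.cos q₁)) / (2 + (Real.cos q₀ + Real.cos q₁))) ≤ M q₀ q₁)
    (hM0 : ∀ q₀ q₁ : ℝ, 0 ≤ M q₀ q₁)
    (hsum : haveI : NeZero (2 * k) := ⟨by omega⟩
      ∑ q : TorusSite 2 (2 * k), M (latticeMomentum (2 * k) q 0) (latticeMomentum (2 * k) q 1) ≤
        (((2 * k : ℕ) : ℝ)) ^ 2 * Wbar) :
    haveI : NeZero (2 * k) := ⟨by omega⟩
    klsKernelRiemannSum (2 * k) (windowDict (2 * k) S w) b t ≤ Wbar := by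
  haveI : NeZero (2 * k) := ⟨by omega⟩
  have hL : (0 : ℝ) < (((2 * k : ℕ) : ℝ)) ^ 2 := by positivity
  unfold klsKernelRiemannSum
  rw [div_le_iff₀ hL]
  have hterm : ∀ q ∈ (univ : Finset (TorusSite 2 (2 * k))).erase (neelIndex (2 * k)),
      max (-klsKernel (2 * k) (windowDict (2 * k) S w) b t q) 0 *
          Real.sqrt (dispersion (latticeMomentum (2 * k) q) /
            dispersion (latticeMomentum (2 * k) (q - neelIndex (2 * k)))) ≤
        M (latticeMomentum (2 * k) q 0) (latticeMomentum (2 * k) q 1) := by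
    intro q hq
    have hq' : q ≠ neelIndex (2 * k) := ne_of_mem_erase hq
    have hE1 : dispersion (latticeMomentum (2 * k) q) =
        2 - (Real.cos (latticeMomentum (2 * k) q 0) + Real.cos (latticeMomentum (2 * k) q 1)) := by
      rw [dispersion_latticeMomentum_eq, torusCosSum_two]; norm_num
    have hE2 : dispersion (latticeMomentum (2 * k) (q - neelIndex (2 * k))) =
        2 + (Real.cos (latticeMomentum (2 * k) q 0) + Real.cos (latticeMomentum (2 * k) q 1)) := by
      rw [dispersion_latticeMomentum_sub_neelIndex k q, torusCosSum_two]; norm_num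
    have hpos : 0 < 2 + (Real.cos (latticeMomentum (2 * k) q 0) +
        Real.cos (latticeMomentum (2 * k) q 1)) := by
      rw [← hE2]; exact dispersion_latticeMomentum_pos (sub_ne_zero.2 hq')
    rw [klsKernel_windowDict_eq_fun, hE1, hE2]
    exact hdom _ _ (by linarith)
  calc ∑ q ∈ (univ : Finset (TorusSite 2 (2 * k))).erase (neelIndex (2 * k)),
        max (-klsKernel (2 * k) (windowDict (2 * k) S w) b t q) 0 *
          Real.sqrt (dispersion (latticeMomentum (2 * k) q) /
            dispersion (latticeMomentum (2 * k) (q - neelIndex (2 * k))))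
      ≤ ∑ q ∈ (univ : Finset (TorusSite 2 (2 * k))).erase (neelIndex (2 * k)),
          M (latticeMomentum (2 * k) q 0) (latticeMomentum (2 * k) q 1) := sum_le_sum hterm
    _ ≤ ∑ q : TorusSite 2 (2 * k), M (latticeMomentum (2 * k) q 0) (latticeMomentum (2 * k) q 1) :=
        sum_le_sum_of_subset_of_nonneg (erase_subset _ _) fun q _ _ => hM0 _ _
    _ ≤ Wbar * (((2 * k : ℕ) : ℝ)) ^ 2 := by linarith [hsum]

/-! ### Character orthogonality for cosine tables -/

/-- `Σ_q cos(m q₀) cos(m' q₁) = 0` on the dual torus of side `L` for `(m,m') ≠ (0,0)`, `m, m' < L`.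
HONEST FRAMING: ladder R1–R4 with certified numbers; no claim on H/H₀. -/
theorem sum_cosTableFun_eq_zero (L : ℕ) [NeZero L] (m m' : ℕ) (hm : m < L) (hm' : m' < L)
    (h : ¬(m = 0 ∧ m' = 0)) :
    ∑ q : TorusSite 2 L, cosTableFun m m' (latticeMomentum L q 0) (latticeMomentum L q 1) = 0 := by
  have hm0 : ((m : ℕ) : ZMod L) = 0 → m = 0 := fun e =>
    Nat.eq_zero_of_dvd_of_lt ((ZMod.natCast_eq_zero_iff m L).1 e) hm
  have hm0' : ((m' : ℕ) : ZMod L) = 0 → m' = 0 := fun e =>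
    Nat.eq_zero_of_dvd_of_lt ((ZMod.natCast_eq_zero_iff m' L).1 e) hm'
  have h01 : (0 : Fin 2) ≠ 1 := by decide
  have hne1 : (Pi.single (0 : Fin 2) ((m : ℕ) : ZMod L) + Pi.single 1 ((m' : ℕ) : ZMod L) :
      TorusSite 2 L) ≠ 0 := by
    intro hw
    have e0 := congr_fun hw 0
    have e1 := congr_fun hw 1
    simp only [Pi.add_apply, Pi.single_eq_same, Pi.single_eq_of_ne h01, Pi.single_eq_of_ne h01.symm,
      add_zero, zero_add, Pi.zero_apply] at e0 e1
    exact h ⟨hm0 e0, hm0' e1⟩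
  have hne2 : (Pi.single (0 : Fin 2) ((m : ℕ) : ZMod L) - Pi.single 1 ((m' : ℕ) : ZMod L) :
      TorusSite 2 L) ≠ 0 := by
    intro hw
    have e0 := congr_fun hw 0
    have e1 := congr_fun hw 1
    simp only [Pi.sub_apply, Pi.single_eq_same, Pi.single_eq_of_ne h01, Pi.single_eq_of_ne h01.symm,
      sub_zero, zero_sub, neg_eq_zero, Pi.zero_apply] at e0 e1
    exact h ⟨hm0 e0, hm0' e1⟩
  simp_rw [cosTableFun, cos_natCast_mul_latticeMomentum, cos_torusPhase_mul_cos_torusPhase]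
  rw [← sum_div, sum_add_distrib, sum_cos_torusPhase, sum_cos_torusPhase, if_neg hne1, if_neg hne2]
  norm_num

/-- **A cosine table without constant term averages to zero** on every torus whose side exceeds all
its frequencies. HONEST FRAMING: ladder R1–R4 with certified numbers; no claim on H/H₀. -/
theorem sum_cosTable (L : ℕ) [NeZero L] (T : Finset (ℕ × ℕ)) (ν : ℕ × ℕ → ℝ)
    (hT : ∀ p ∈ T, p.1 < L ∧ p.2 < L) (h0 : ∀ p ∈ T, ¬(p.1 = 0 ∧ p.2 = 0)) :
    ∑ q : TorusSite 2 L, ∑ p ∈ T, ν p *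
        cosTableFun p.1 p.2 (latticeMomentum L q 0) (latticeMomentum L q 1) = 0 := by
  rw [sum_comm]
  refine sum_eq_zero fun p hp => ?_
  rw [← mul_sum, sum_cosTableFun_eq_zero L p.1 p.2 (hT p hp).1 (hT p hp).2 (h0 p hp), mul_zero]

/-- `|(ℤ/Lℤ)²| = L²` (real form). HONEST FRAMING: ladder R1–R4 with certified numbers; no claim on
H/H₀. -/
theorem card_torusSite_two_real (L : ℕ) [NeZero L] :
    (Fintype.card (TorusSite 2 L) : ℝ) = (L : ℝ) ^ 2 := by
  rw [Fintype.card_pi, prod_const, ZMod.card, card_univ, Fintype.card_fin]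
  push_cast
  ring

/-- **Lattice average of a cosine-table majorant**: if `M(q₀,q₁) = ν₀ + Σ_{(m,m')∈T} ν(m,m') cos(m q₀) cos(m' q₁)`
identically, with all frequencies `< L` and `(0,0) ∉ T`, then `Σ_q M = L² ν₀`.
HONEST FRAMING: ladder R1–R4 with certified numbers; no claim on H/H₀. -/
theorem sum_majorant_of_cosTable (L : ℕ) [NeZero L] (M : ℝ → ℝ → ℝ) (ν₀ : ℝ) (T : Finset (ℕ × ℕ))
    (ν : ℕ × ℕ → ℝ) (hT : ∀ p ∈ T, p.1 < L ∧ p.2 < L) (h0 : ∀ p ∈ T, ¬(p.1 = 0 ∧ p.2 = 0))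
    (hM : ∀ q₀ q₁ : ℝ, M q₀ q₁ = ν₀ + ∑ p ∈ T, ν p * cosTableFun p.1 p.2 q₀ q₁) :
    ∑ q : TorusSite 2 L, M (latticeMomentum L q 0) (latticeMomentum L q 1) = (L : ℝ) ^ 2 * ν₀ := by
  simp_rw [hM]
  rw [sum_add_distrib, sum_cosTable L T ν hT h0, add_zero, sum_const, card_univ, nsmul_eq_mul,
    card_torusSite_two_real]

/-- **The two generic steps combined**: pointwise domination by a cosine-table majorant with constant
term `W̄` and frequencies `≤ D < 2k` gives `𝓦_K(2k) ≤ W̄`.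
HONEST FRAMING: ladder R1–R4 with certified numbers; no claim on H/H₀.
[cite: KLS1988JSP, eqs. (4), (6)-(9)] -/
theorem klsKernelRiemannSum_windowDict_le_of_cosTable (k : ℕ) (hk : 1 ≤ k) (S : Finset (ℕ × ℕ))
    (w : ℕ × ℕ → ℝ) (b t Wbar : ℝ) (M : ℝ → ℝ → ℝ) (T : Finset (ℕ × ℕ)) (ν : ℕ × ℕ → ℝ)
    (hT : ∀ p ∈ T, p.1 < 2 * k ∧ p.2 < 2 * k) (h0 : ∀ p ∈ T, ¬(p.1 = 0 ∧ p.2 = 0))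
    (hM : ∀ q₀ q₁ : ℝ, M q₀ q₁ = Wbar + ∑ p ∈ T, ν p * cosTableFun p.1 p.2 q₀ q₁)
    (hdom : ∀ q₀ q₁ : ℝ, -2 < Real.cos q₀ + Real.cos q₁ →
      max (-windowKernelFun S w b t q₀ q₁) 0 *
          Real.sqrt ((2 - (Real.cos q₀ + Real.cos q₁)) / (2 + (Real.cos q₀ + Real.cos q₁))) ≤ M q₀ q₁)
    (hM0 : ∀ q₀ q₁ : ℝ, 0 ≤ M q₀ q₁) :
    haveI : NeZero (2 * k) := ⟨by omega⟩
    klsKernelRiemannSum (2 * k) (windowDict (2 * k) S w) b t ≤ Wbar := by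
  haveI : NeZero (2 * k) := ⟨by omega⟩
  refine klsKernelRiemannSum_windowDict_le_of_majorant k hk S w b t Wbar M hdom hM0 ?_
  rw [sum_majorant_of_cosTable (2 * k) M Wbar T ν hT h0 hM]


/-! ### Fiberwise Bernstein certificates (device D39)

On the fiber `s = u + v` fixed (`u = cos q₀`, `v = cos q₁`), `y = (u - v)²` ranges in `[0, Y(s)]` with
`Y = (2 + s)²` usable for `s ≤ 0` and `Y = (2 - s)²` for `s ≥ 0` (both bounds hold everywhere:
`(2 ± s)² - (u - v)² = 4(1 ± u)(1 ± v) ≥ 0`).  A polynomial `G(y) = Σ_{j ≤ 4} G_j y^j` is `≥ 0` on the fiber as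
soon as its degree-4 Bernstein coefficients (polynomials in `s`) are, via the identity
`Y⁴ G = Σ_i β_i · C(4,i) yⁱ (Y - y)^{4-i}`; a coefficient of the form `a + σ(s) b`, `σ = ((2-s)/(2+s))^{1/2}`,
is `≥ 0` if `a, b ≥ 0` (`coefP`) or if `a ≥ 0 ∧ a²(2+s) ≥ b²(2-s)` (`coefQ`). [folklore] -/

/-- `(u - v)² ≤ (2 + (u + v))²` for cosines `u, v`. [folklore] -/
theorem fiber_sq_le_neg (q₀ q₁ : ℝ) :
    (Real.cos q₀ - Real.cos q₁) ^ 2 ≤ (2 + (Real.cos q₀ + Real.cos q₁)) ^ 2 := by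
  have h1 := Real.neg_one_le_cos q₀
  have h2 := Real.neg_one_le_cos q₁
  nlinarith [mul_nonneg (by linarith : 0 ≤ 1 + Real.cos q₀) (by linarith : 0 ≤ 1 + Real.cos q₁)]

/-- `(u - v)² ≤ (2 - (u + v))²` for cosines `u, v`. [folklore] -/
theorem fiber_sq_le_pos (q₀ q₁ : ℝ) :
    (Real.cos q₀ - Real.cos q₁) ^ 2 ≤ (2 - (Real.cos q₀ + Real.cos q₁)) ^ 2 := by
  have h1 := Real.cos_le_one q₀
  have h2 := Real.cos_le_one q₁
  nlinarith [mul_nonneg (by linarith : 0 ≤ 1 - Real.cos q₀) (by linarith : 0 ≤ 1 - Real.cos q₁)]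

/-- `Yⁿ G ≥ 0` with `Y > 0` gives `G ≥ 0`. [folklore] -/
theorem nonneg_of_pow_mul_nonneg {Y G : ℝ} (n : ℕ) (hY : 0 < Y) (h : 0 ≤ Y ^ n * G) : 0 ≤ G := by
  refine not_lt.mp fun hG => ?_
  have := mul_neg_of_pos_of_neg (pow_pos hY n) hG
  linarith

/-- **Degree-4 fiber Bernstein certificate**: nonnegative Bernstein coefficients on `[0, Y]` give `G ≥ 0`
there. [folklore] -/
theorem fiber_nonneg_bern4 {Y y G c0 c1 c2 c3 c4 : ℝ} (hY : 0 < Y) (hy0 : 0 ≤ y) (hyY : y ≤ Y)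
    (hG : Y ^ 4 * G = c0 * (Y - y) ^ 4 + c1 * (4 * y * (Y - y) ^ 3) + c2 * (6 * y ^ 2 * (Y - y) ^ 2) +
      c3 * (4 * y ^ 3 * (Y - y)) + c4 * y ^ 4)
    (h0 : 0 ≤ c0) (h1 : 0 ≤ c1) (h2 : 0 ≤ c2) (h3 : 0 ≤ c3) (h4 : 0 ≤ c4) : 0 ≤ G := by
  have hYy : 0 ≤ Y - y := by linarith
  refine nonneg_of_pow_mul_nonneg 4 hY ?_
  rw [hG]
  positivity

/-- **Degree-6 fiber Bernstein certificate**. [folklore] -/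
theorem fiber_nonneg_bern6 {Y y G c0 c1 c2 c3 c4 c5 c6 : ℝ} (hY : 0 < Y) (hy0 : 0 ≤ y) (hyY : y ≤ Y)
    (hG : Y ^ 6 * G = c0 * (Y - y) ^ 6 + c1 * (6 * y * (Y - y) ^ 5) + c2 * (15 * y ^ 2 * (Y - y) ^ 4) +
      c3 * (20 * y ^ 3 * (Y - y) ^ 3) + c4 * (15 * y ^ 4 * (Y - y) ^ 2) + c5 * (6 * y ^ 5 * (Y - y)) +
      c6 * y ^ 6)
    (h0 : 0 ≤ c0) (h1 : 0 ≤ c1) (h2 : 0 ≤ c2) (h3 : 0 ≤ c3) (h4 : 0 ≤ c4) (h5 : 0 ≤ c5) (h6 : 0 ≤ c6) :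
    0 ≤ G := by
  have hYy : 0 ≤ Y - y := by linarith
  refine nonneg_of_pow_mul_nonneg 6 hY ?_
  rw [hG]
  positivity

/-- A coefficient `a + σ b` with `a, b, σ ≥ 0` is `≥ 0`. [folklore] -/
theorem coefP {a b σ : ℝ} (ha : 0 ≤ a) (hb : 0 ≤ b) (hσ : 0 ≤ σ) : 0 ≤ a + σ * b := by positivity

/-- A coefficient `a + σ(s) b`, `σ = ((2-s)/(2+s))^{1/2}`, is `≥ 0` if `a ≥ 0` and `a²(2+s) ≥ b²(2-s)`
(then `|b| σ ≤ a`). [folklore] -/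
theorem coefQ {a b s : ℝ} (hs : -2 < s) (hs2 : s ≤ 2) (ha : 0 ≤ a)
    (hq : 0 ≤ a ^ 2 * (2 + s) - b ^ 2 * (2 - s)) : 0 ≤ a + Real.sqrt ((2 - s) / (2 + s)) * b := by
  have h2s : 0 < 2 + s := by linarith
  have hσ : 0 ≤ Real.sqrt ((2 - s) / (2 + s)) := Real.sqrt_nonneg _
  have hfrac : 0 ≤ (2 - s) / (2 + s) := div_nonneg (by linarith) h2s.le
  have key : |b| * Real.sqrt ((2 - s) / (2 + s)) ≤ a := by
    have hsq : (|b| * Real.sqrt ((2 - s) / (2 + s))) ^ 2 ≤ a ^ 2 := by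
      rw [mul_pow, Real.sq_sqrt hfrac, sq_abs, ← mul_div_assoc, div_le_iff₀ h2s]
      linarith
    nlinarith [abs_nonneg (|b| * Real.sqrt ((2 - s) / (2 + s)) - a),
      mul_nonneg (abs_nonneg b) hσ, sq_nonneg (|b| * Real.sqrt ((2 - s) / (2 + s)) + a)]
  have hb : -(|b|) ≤ b := neg_abs_le b
  nlinarith [mul_le_mul_of_nonneg_left hb hσ]

/-- From the two fiber claims `M ≥ 0` and `M + σ W ≥ 0`: `max(-W, 0) σ ≤ M`. [folklore] -/
theorem dom_of_fiber {W M σ : ℝ} (h1 : 0 ≤ M) (h2 : 0 ≤ M + σ * W) :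
    max (-W) 0 * σ ≤ M := by
  rcases le_total (-W) 0 with h | h
  · rw [max_eq_right h, zero_mul]; exact h1
  · rw [max_eq_left h]; nlinarith

/-- `cos 4x` as a polynomial in `cos x` — the landed tree lemma `Summit.HubbardSuperconductivity.HubbardSuperconductivity.Theorems.MesoscopicPairOrder.Negative.cos_four_mul_eq`, re-exported under
this file's name (filer's `dedup.landed` edit of LEAN FILING REQUEST #190.1; statement unchanged). -/
alias cos_four_mul' := Summit.HubbardSuperconductivity.HubbardSuperconductivity.Theorems.MesoscopicPairOrder.Negative.cos_four_mul_eq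

/-- `cos 5x` as a polynomial in `cos x` — the landed tree lemma `Summit.HubbardSuperconductivity.HubbardSuperconductivity.Theorems.MesoscopicPairOrder.Negative.cos_five_mul_eq`, re-exported under
this file's name (filer's `dedup.landed` edit of LEAN FILING REQUEST #190.1; statement unchanged). -/
alias cos_five_mul' := Summit.HubbardSuperconductivity.HubbardSuperconductivity.Theorems.MesoscopicPairOrder.Negative.cos_five_mul_eq

/-- Chebyshev recurrence `cos((k+2)x) = 2 cos x cos((k+1)x) - cos(kx)`. [folklore] -/
theorem cos_nat_add_two_mul (k : ℕ) (x : ℝ) :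
    Real.cos (((k + 2 : ℕ) : ℝ) * x) = 2 * Real.cos x * Real.cos (((k + 1 : ℕ) : ℝ) * x) - Real.cos ((k : ℝ) * x) := by
  have h := Real.cos_add_cos (((k + 2 : ℕ) : ℝ) * x) ((k : ℝ) * x)
  have e1 : ((((k + 2 : ℕ) : ℝ) * x) + (k : ℝ) * x) / 2 = ((k + 1 : ℕ) : ℝ) * x := by push_cast; ring
  have e2 : ((((k + 2 : ℕ) : ℝ) * x) - (k : ℝ) * x) / 2 = x := by push_cast; ring
  rw [e1, e2] at h
  linarith [h, mul_comm (Real.cos (((k + 1 : ℕ) : ℝ) * x)) (Real.cos x)]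

/-- `cos 6x` as a polynomial in `cos x` — the landed tree lemma `Summit.HubbardSuperconductivity.HubbardSuperconductivity.Theorems.MesoscopicPairOrder.Negative.cos_six_mul_eq`, re-exported under
this file's name (filer's `dedup.landed` edit of LEAN FILING REQUEST #190.1; statement unchanged). -/
alias cos_six_mul' := Summit.HubbardSuperconductivity.HubbardSuperconductivity.Theorems.MesoscopicPairOrder.Negative.cos_six_mul_eq

/-- `cos 7x` as a polynomial in `cos x` — the landed tree lemma `Summit.HubbardSuperconductivity.HubbardSuperconductivity.Theorems.MesoscopicPairOrder.Negative.cos_seven_mul_eq`, re-exported under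
this file's name (filer's `dedup.landed` edit of LEAN FILING REQUEST #190.1; statement unchanged). -/
alias cos_seven_mul' := Summit.HubbardSuperconductivity.HubbardSuperconductivity.Theorems.MesoscopicPairOrder.Negative.cos_seven_mul_eq

/-- `cos 8x` as a polynomial in `cos x` — the landed tree lemma `Summit.HubbardSuperconductivity.HubbardSuperconductivity.Theorems.MesoscopicPairOrder.Negative.cos_eight_mul_eq`, re-exported under
this file's name (filer's `dedup.landed` edit of LEAN FILING REQUEST #190.1; statement unchanged). -/
alias cos_eight_mul' := Summit.HubbardSuperconductivity.HubbardSuperconductivity.Theorems.MesoscopicPairOrder.Negative.cos_eight_mul_eq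

/-- `cos 9x` as a polynomial in `cos x` (Chebyshev `T_9`). [folklore] -/
theorem cos_nine_mul' (x : ℝ) :
    Real.cos (9 * x) = 256 * Real.cos x ^ 9 - 576 * Real.cos x ^ 7 + 432 * Real.cos x ^ 5 - 120 * Real.cos x ^ 3 + 9 * Real.cos x := by
  have h := cos_nat_add_two_mul 7 x
  norm_num at h
  rw [h, cos_eight_mul', cos_seven_mul']
  ring

/-- `cos 10x` as a polynomial in `cos x` (Chebyshev `T_10`). [folklore] -/
theorem cos_ten_mul' (x : ℝ) :
    Real.cos (10 * x) = 512 * Real.cos x ^ 10 - 1280 * Real.cos x ^ 8 + 1120 * Real.cos x ^ 6 - 400 * Real.cos x ^ 4 + 50 * Real.cos x ^ 2 - 1 := by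
  have h := cos_nat_add_two_mul 8 x
  norm_num at h
  rw [h, cos_nine_mul', cos_eight_mul']
  ring

/-- `cos 11x` as a polynomial in `cos x` (Chebyshev `T_11`). [folklore] -/
theorem cos_eleven_mul' (x : ℝ) :
    Real.cos (11 * x) = 1024 * Real.cos x ^ 11 - 2816 * Real.cos x ^ 9 + 2816 * Real.cos x ^ 7 - 1232 * Real.cos x ^ 5 + 220 * Real.cos x ^ 3 - 11 * Real.cos x := by
  have h := cos_nat_add_two_mul 9 x
  norm_num at h
  rw [h, cos_ten_mul', cos_nine_mul']
  ring

/-- `cos 12x` as a polynomial in `cos x` (Chebyshev `T_12`). [folklore] -/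
theorem cos_twelve_mul' (x : ℝ) :
    Real.cos (12 * x) = 2048 * Real.cos x ^ 12 - 6144 * Real.cos x ^ 10 + 6912 * Real.cos x ^ 8 - 3584 * Real.cos x ^ 6 + 840 * Real.cos x ^ 4 - 72 * Real.cos x ^ 2 + 1 := by
  have h := cos_nat_add_two_mul 10 x
  norm_num at h
  rw [h, cos_eleven_mul', cos_ten_mul']
  ring

end Summit.HubbardSuperconductivity.HubbardLadder
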